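import Literature.NumberTheory.Transcendental.PreBlochHalf
import HarnessLib

/-!
# Unique divisibility of `P(F)`: what is proved and what remains (Dupont, Thm. 8.16)

NumberTheory/Transcendental proof file (no new definitions, no new named facts) for the named fact
`Literature.NumberTheory.Transcendental.Suslin1991_preBloch_isUniquelyDivisible`
(`PreBlochGroup.lean`; Dupont, *Scissors congruences, group homology and characteristic classes*
(2001), **Thm. 8.16**: "For `F` algebraically closed of characteristic zero `𝒫_F` is uniquely
divisible").

Proved in the tree along the printed proof (Dupont pp. 42–43, Dupont–Sah 1982 §5):
`PreBloch.nsmul_surjective` (divisibility by every `n ≥ 1`, from Rogers' identity and the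
distribution relation, `PreBlochRogersProofs.lean`) and `PreBloch.two_nsmul_injective` (no
`2`-torsion, Dupont's case `n = 2`, `PreBlochHalf.lean`). This file assembles them:
`isUniquelyDivisible_of_odd_prime_injective` — `IsUniquelyDivisible (PreBloch F)` follows from the
injectivity of `p • (·)` for the odd primes `p` alone, which is the part of Thm. 8.16 that Dupont
defers to Suslin ("In general this is rather complicated and uses more algebraic geometry. We refer
to [Suslin, 1986]") and which is **not** proved here. The named fact therefore stays a fact; a proof
of the odd-prime injectivity (Suslin's theorem) turns this file's theorem into its discharge.

## References

* J. L. Dupont, *Scissors congruences, group homology and characteristic classes*, World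
  Scientific 2001: Thm. 8.16 and its sketch proof, p. 43. [Dupont2001]
* A. A. Suslin, *Algebraic K-theory of fields*, Proc. ICM Berkeley 1986, 222–244; *`K₃` of a
  field and the Bloch group*, Proc. Steklov Inst. Math. 183 (1991). [Suslin1991]
-/


namespace Literature.NumberTheory.Transcendental

namespace PreBloch

variable {F : Type*} [Field F]

/-- Injectivity of `n • (·)` for every `n ≥ 1` follows from injectivity of `p • (·)` for every prime
`p` (prime factorisation). [folklore] -/
theorem nsmul_injective_of_prime {M : Type*} [AddCommMonoid M]
    (h : ∀ p : ℕ, p.Prime → Function.Injective fun a : M => p • a) {n : ℕ} (hn : 0 < n) :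
    Function.Injective fun a : M => n • a := by
  induction n using Nat.strong_induction_on with
  | _ n IH =>
  rcases Nat.lt_or_ge n 2 with h1 | h2
  · have hn1 : n = 1 := by omega
    subst hn1
    intro a b hab
    simpa using hab
  · obtain ⟨p, hp, hpn⟩ := Nat.exists_prime_and_dvd (show n ≠ 1 by omega)
    obtain ⟨m, rfl⟩ := hpn
    have hm : 0 < m := Nat.pos_of_mul_pos_left hn
    have hmn : m < p * m := by
      have := hp.one_lt
      nlinarith
    have hcomp : (fun a : M => (p * m) • a) = (fun a : M => p • a) ∘ fun a : M => m • a := by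
      funext a
      simp only [Function.comp_apply, mul_comm p m, mul_nsmul]
    rw [hcomp]
    exact (h p hp).comp (IH m hmn hm)

/-- **What remains of Dupont, Thm. 8.16.** For `F` algebraically closed of characteristic `0`,
`P(F)` is uniquely divisible as soon as `p • (·)` is injective on `P(F)` for every odd prime `p`
(Suslin's theorem; Dupont p. 43: "In general this is rather complicated and uses more algebraic
geometry. We refer to [Suslin, 1986]"): divisibility by every `n` is `nsmul_surjective`
(Cor. 8.15), injectivity for `p = 2` is `two_nsmul_injective` ((8.17)), and injectivity for
general `n` follows by prime factorisation. [cite: Dupont2001, Thm. 8.16] -/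
theorem isUniquelyDivisible_of_odd_prime_injective [IsAlgClosed F] [CharZero F]
    (h : ∀ p : ℕ, p.Prime → p ≠ 2 → Function.Injective fun a : PreBloch F => p • a) :
    IsUniquelyDivisible (PreBloch F) := by
  intro n hn
  refine ⟨nsmul_injective_of_prime (fun p hp => ?_) hn, nsmul_surjective hn⟩
  by_cases hp2 : p = 2
  · subst hp2
    exact two_nsmul_injective
  · exact h p hp hp2

end PreBloch

end Literature.NumberTheory.Transcendental
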